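import Mathlib

/-!
# Transfer-operator positivity does NOT give `0 ≤ ⟨P ; τ_m P⟩` for observables straddling two
# time slices — a two-state certificate (crux `TunedSequenceExists`, clause (iii))

Context (crux stmt-QuantumFields-10524, `ParabolicTrajectory.TunedSequenceExists`, lead c2,
2026-08-16).  Clause (iii) of the crux costs an a-priori bound on the rescaled correlators
`N_t`, `t ≥ 2`, along the tuned witness (standing Disproof § ClauseThree, `AprioriBound`); the
disprover's suggested input is `CorrMonotoneNonneg` — positivity and monotone decay in the
separation of the finite-torus two-point function of `P = r.curvature.F`, "physically
`0 ≤ N_t ≤ N_1` by positivity of the transfer operator".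

For a TIME-ZERO observable `A` (multiplication operator on one slice) transfer-operator
positivity `T ≥ 0` indeed gives `⟨A ; τ_m A⟩ = ∑_{i ≥ 1} λᵢ^m |aᵢ|² ≥ 0`, decreasing in `m`
(any torus side, by log-convexity of `m ↦ Tr(T^{S-m} Â T^m Â)` and Cauchy–Schwarz at the
midpoint).  But the crux's `P` — the Wilson action density at the origin corner, three spatial
plaquettes in the slice `t = 0` plus three temporal plaquettes on the step `0 → 1` — STRADDLES two
slices asymmetrically.  Writing `F̂` for the spatial part (multiplication at the earlier slice)
and `𝒢` for the temporal part (the one-step kernel weighted by the plaquette function, symmetric),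
the one-step operator carrying `P` is `E = F̂ T + 𝒢`, NOT self-adjoint, and

  `⟨P ; τ_m P⟩ = ⟨Eᵀ Ω, T^{m-1} E Ω⟩ - ⟨P⟩² = ∑_{i ≥ 1} λᵢ^{m-1} (λᵢ aᵢ + pᵢ)(aᵢ + pᵢ)`,

`aᵢ = ⟨eᵢ, F̂ Ω⟩`, `pᵢ = ⟨eᵢ, 𝒢 Ω⟩`, whose coefficients are INDEFINITE: `(λ a + p)(a + p) < 0`
whenever `-p/a ∈ (λ, 1)`.

This file certifies the phenomenon on the smallest example, with exact rational arithmetic: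
a stationary two-state chain with symmetric, entrywise positive, positive-semidefinite
(= reflection positive for site AND link reflections) doubly stochastic transfer matrix
`T = [[3/4, 1/4], [1/4, 3/4]]` (eigenvalues `1, 1/2`), uniform invariant law, and the straddling
observable `P(t) = f(x_t) + g(x_t, x_{t+1})` with `f = (2, 0)`, `g = diag(0, 2)` (symmetric, so
`P` is as "local and real" as a plaquette sum).  Then

  `⟨P(0) P(2)⟩ - ⟨P⟩² = 97/32 - (7/4)² = -1/32 < 0`   (`corr_two_neg`),
  `⟨P(0) P(3)⟩ - ⟨P⟩² = -1/64 < 0`                     (`corr_three_neg`),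

matching `-(1/16)·(1/2)^{m-1}` from the spectral formula (`a₁ = 1`, `p₁ = -3/4`, `λ₁ = 1/2`).
So NO argument from `T ≥ 0` alone can deliver `CorrMonotoneNonneg r` / `AprioriBound r M` for the
corner action density; for Wilson's theory positivity of `⟨P ; τ_m P⟩` is a dynamical fact (true at
both coupling ends by cluster / Gaussian expansion), and the a-priori bound of clause (iii) is a
UV-regularity input (canonical-scaling UPPER bounds on the RP-diagonal correlators
`⟨P ; θ P⟩`, through `|⟨A θ C⟩|² ≤ ⟨A θ A⟩⟨C θ C⟩`), not reflection-positivity glue.  A route that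
wants clause (iii) from the transfer matrix must restate (A), (B), (S) with a reflection-symmetric
curvature observable (e.g. the spatial plaquettes of one slice, or the 2⁴-corner-symmetrised
clover density).
-/

namespace Summit.QuantumFields.YangMills.Cruxes.TunedSequenceExists.RPStraddle

/-- The transfer matrix `T = [[3/4, 1/4], [1/4, 3/4]]` (symmetric, entrywise positive, doubly
stochastic; eigenvalues `1` and `1/2`). -/
def T : Fin 2 → Fin 2 → ℚ := fun x y => if x = y then 3 / 4 else 1 / 4

/-- The invariant (uniform) law `π = (1/2, 1/2)`. -/
def π : Fin 2 → ℚ := fun _ => 1 / 2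

/-- Spatial part `f = (2, 0)` (multiplication at the earlier slice). -/
def f : Fin 2 → ℚ := fun x => if x = 0 then 2 else 0

/-- Temporal part `g = diag(0, 2)` on the step `(x_t, x_{t+1})` (symmetric). -/
def g : Fin 2 → Fin 2 → ℚ := fun x y => if x = 1 ∧ y = 1 then 2 else 0

/-- The straddling observable on a step: `P(x, y) = f x + g x y`. -/
def P (x y : Fin 2) : ℚ := f x + g x y

/-- `⟨P⟩ = ∑ π(x₀) T(x₀,x₁) P(x₀,x₁)`. -/
def meanP : ℚ := ∑ x₀ : Fin 2, ∑ x₁ : Fin 2, π x₀ * T x₀ x₁ * P x₀ x₁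

/-- `⟨P(0) P(2)⟩ = ∑ π(x₀) T(x₀,x₁) T(x₁,x₂) T(x₂,x₃) P(x₀,x₁) P(x₂,x₃)` (path law of the
stationary chain on times `0..3`). -/
def corrTwo : ℚ :=
  ∑ x₀ : Fin 2, ∑ x₁ : Fin 2, ∑ x₂ : Fin 2, ∑ x₃ : Fin 2,
    π x₀ * T x₀ x₁ * T x₁ x₂ * T x₂ x₃ * (P x₀ x₁ * P x₂ x₃)

/-- `⟨P(0) P(3)⟩` (times `0..4`). -/
def corrThree : ℚ :=
  ∑ x₀ : Fin 2, ∑ x₁ : Fin 2, ∑ x₂ : Fin 2, ∑ x₃ : Fin 2, ∑ x₄ : Fin 2,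
    π x₀ * T x₀ x₁ * T x₁ x₂ * T x₂ x₃ * T x₃ x₄ * (P x₀ x₁ * P x₃ x₄)

/-- `T` is symmetric. -/
theorem T_symm (x y : Fin 2) : T x y = T y x := by
  fin_cases x <;> fin_cases y <;> simp [T]

/-- `T` is entrywise positive. -/
theorem T_pos (x y : Fin 2) : 0 < T x y := by
  fin_cases x <;> fin_cases y <;> norm_num [T]

/-- `T` is stochastic (rows sum to one; with symmetry, doubly stochastic), so `π` is invariant. -/
theorem T_row_sum (x : Fin 2) : ∑ y : Fin 2, T x y = 1 := by
  fin_cases x <;> simp [T, Fin.sum_univ_two] <;> norm_num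

/-- `π` is a probability vector invariant under `T`. -/
theorem π_invariant (y : Fin 2) : ∑ x : Fin 2, π x * T x y = π y := by
  fin_cases y <;> simp [T, π, Fin.sum_univ_two] <;> norm_num

/-- **Transfer-operator positivity** (`T ≥ 0` as a quadratic form — the input behind reflection
positivity for both site and link reflections of the chain):
`vᵀ T v = ((v₀ + v₁)² + 2 v₀² + 2 v₁²)/4 ≥ 0`. -/
theorem T_posSemidef (v : Fin 2 → ℚ) : 0 ≤ ∑ x : Fin 2, ∑ y : Fin 2, v x * T x y * v y := by
  simp only [T, Fin.sum_univ_two, Fin.isValue, ↓reduceIte, one_ne_zero, zero_ne_one]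
  nlinarith [sq_nonneg (v 0 + v 1), sq_nonneg (v 0), sq_nonneg (v 1)]

/-- The temporal part is symmetric (the observable is invariant under reversing the step). -/
theorem g_symm (x y : Fin 2) : g x y = g y x := by
  fin_cases x <;> fin_cases y <;> simp [g]

/-- `⟨P⟩ = 7/4`. -/
theorem meanP_eq : meanP = 7 / 4 := by
  simp [meanP, P, f, g, T, π, Fin.sum_univ_two]
  norm_num

/-- `⟨P(0) P(2)⟩ = 97/32`. -/
theorem corrTwo_eq : corrTwo = 97 / 32 := by
  simp [corrTwo, P, f, g, T, π, Fin.sum_univ_two]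
  norm_num

/-- `⟨P(0) P(3)⟩ = 195/64`. -/
theorem corrThree_eq : corrThree = 195 / 64 := by
  simp [corrThree, P, f, g, T, π, Fin.sum_univ_two]
  norm_num

/-- **The connected two-point function at separation 2 is NEGATIVE**: `97/32 - 49/16 = -1/32`. -/
theorem corr_two_neg : corrTwo - meanP ^ 2 = -1 / 32 := by
  rw [corrTwo_eq, meanP_eq]; norm_num

/-- **… and at separation 3**: `195/64 - 49/16 = -1/64` (`= -(1/16)·(1/2)²`, the spectral
prediction `λ₁^{m-1}(λ₁a₁ + p₁)(a₁ + p₁)` with `λ₁ = 1/2`, `a₁ = 1`, `p₁ = -3/4`). -/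
theorem corr_three_neg : corrThree - meanP ^ 2 = -1 / 64 := by
  rw [corrThree_eq, meanP_eq]; norm_num

/-- Summary: a reflection-positive (`T ≥ 0`) stationary chain and a straddling observable with
negative connected correlations at separations `2` and `3`. -/
theorem straddling_correlator_negative :
    (∀ v : Fin 2 → ℚ, 0 ≤ ∑ x : Fin 2, ∑ y : Fin 2, v x * T x y * v y) ∧
      corrTwo - meanP ^ 2 < 0 ∧ corrThree - meanP ^ 2 < 0 := by
  refine ⟨T_posSemidef, ?_, ?_⟩
  · rw [corr_two_neg]; norm_num
  · rw [corr_three_neg]; norm_num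

end Summit.QuantumFields.YangMills.Cruxes.TunedSequenceExists.RPStraddle
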